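import Literature.MathematicalPhysics.QuantumFieldTheory.Balaban1983to89.B5DPD126Uniform
import Literature.MathematicalPhysics.QuantumFieldTheory.Balaban1983to89.B5AveragingTorus

/-!
Copyright: public-domain mathematics; typed transcription for the H21 Literature library (cell pub-balaban,
PAPER SUB-CELL B05 gen 8, node BOUND-128-UNIFORM = cell census G-B5-39 (iii)).

# Bałaban, *Propagators and renormalization transformations for lattice gauge theories. I*,
# Commun. Math. Phys. **95** (1984) 17–40 — (1.128) in the torus multiplier model with a `k`-UNIFORM
# constant and rate, from the `k`-uniform (1.126) of `B5DPD126Uniform`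

[cite: Balaban1984PropagatorsI]  T. Bałaban, Commun. Math. Phys. 95 (1984) 17–40 (= B5 of the series).  Quotations
(read by this seat from the page render `1984-cmp95-propagators-rt-I-p022-x2.png` as an image; journal page = PDF
page + 16), p. 38 [PDF 22]:

* after (1.127): «The constant O(1) in (1.126) depends on d only, and in (1.127) it depends on α also (O(1) → ∞ if
  α → 1). This implies a bound on the operator h_{z₁}K(h_{z₂}). We have to consider separately the cases when □_{z₁},
  □_{z₂} are disjoint, and when they are overlapping. In the first case we have only the operator h_{z₁}P₁(∂h_{z₂})
  and (1.126) gives a bound with a small factor O(M₀⁻¹) and the exponential factor exp(−⅓δ′₀|z₁ − z₂|) =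
  exp(−⅓δ′₀M₀|z′₁ − z′₂|), where z′₁, z′₂ are points z₁, z₂ rescaled to the unit scale, i.e., z′₁, z′₂ ∈ T₁^{(k+m₀)}.
  In the second case we have the small factor O(M₀⁻¹) only, but we may include the factor exp(−|z′₁ − z′₂|) because
  |z′₁ − z′₂| ≦ 2d. Defining 2δ₀ = min{⅓δ′₀, M₀⁻¹}, we obtain
  |h_{z₁}K(h_{z₂})A| ≦ O(M₀⁻¹)e^{−2δ₀|z₁−z₂|}(|∇A| + |A|). (1.128)»

## What this file certifies

pv15's torus-model (1.128) leaf `B5AveragingTorus.h128_balaban_torus` bounds `‖h_{z₁}K(h_{z₂})A‖` for the model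
operator `Δ + a′Q*Q + k` on the vector-field carrier `UT P × Fin D` of a fine torus of periods `P` (UNIT lattice
spacing, cubes of `M₀` lattice sites), for ANY kernel `k` with `|k(i,j)| ≤ C·e^{−δ·dist(i,j)}`; its constant contains
`C·(24/(eδ))·D·latticeConst_D(δ/8)` and its rate is `twoDelta0 δ M₀ = min{δ/3, M₀⁻¹}`.  Fed with the output of the
fine-carrier (1.126) engine (`B5QGGQ145Position.decay126_multiplier`: rate `torusRate126 ≍ n^{−(4D+1)}` per lattice
step, `n = L^k`), both the constant and the rate of (1.128) degenerate polynomially in `n = L^k` (cell GAPS C-A36-1 R1,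
G-B5-39 (iii)).  Here the leaf is fed instead with the `k`-UNIFORM kernel bound of `B5DPD126Uniform`
(`dpd_decay_uniform_fine`: `|dpd| ≤ C·e^{−(δ/n)·dist}` with `δ, C` depending on `d, a₋, a₊` only), for the CONCRETE
kernel of the multiplier model

  `kV n a N (x,μ) (x′,ν) := −(∇ᵘ_μ · (KRe·kerRe·QGRe) · (∇ᵘ_ν)ᵀ)(x,x′)`,  `∇ᵘ_μ` = unit forward difference,

on the fine torus `Π_μ ℤ/(nN_μ)` (`P = n·N`): `kV = −η^{D+2}·dpd` (`kV_eq`; `η = 1/n`, `D = d+1`), so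
`|kV| ≤ (C/n^{D+2})·e^{−(δ/n)·dist}` (`kV_decay`).  RESULT (`h128_uniform_blocks`, `h128_uniform_kfree`): for cubes of
`M₀ = M₀′·n` fine sites (side `M₀′` on the unit scale, as in the paper) the (1.128) constant is
`≤ (4D√(2D)/M₀′ + 52D/M₀′² + 16D|a′|/M₀′)·e^{4+4/M₀′} + E/M₀′` and the rate is `twoDelta0 δ M₀′ = min{δ/3, M₀′⁻¹}`
per UNIT length (`dist/n`), with `δ, E` depending on `d, a₋, a₊` ONLY — no `k`, no volume: the printed
«2δ₀ = min{⅓δ′₀, M₀⁻¹}» with a `k`-independent `δ′₀`, and «O(M₀⁻¹)».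

## Dictionary and HONEST SCOPE

(i) `∇ᵘ` is the UNIT forward difference of the fine torus (`unitDiff`; `B5DPD126Uniform.Dmat = n • unitDiff` is the
`η⁻¹`-difference `∂^η`), so `kV = −η²·(counting-measure matrix of ∂^η_μ P ∂^{η*}_ν)`
(`B5DPD126Uniform.Dmat_matrixP_Dmat_transpose`): the `∂P∂*` block of the `η²`-RESCALED `Δ_a`, the rescaling under
which `η²Δ^η` is the unit-spacing Laplacian `B5Leibniz121.lapKer axisWC` of pv15's model.  The literal identification
of pv15's model operator (normalisation of `a′·gram120(n^D)(avgKer n)`, `M₀` in fine sites, the `‖∇A‖ + ‖A‖` weights)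
with `η²Δ_a` of (1.121) is the `η`-bookkeeping item G-B5-38 (d) of the cell census and is NOT asserted here; this
file proves the displayed inequalities for the displayed operator.  (ii) `U = 1`, `m² = 0` torus multiplier model
only (the whole b05-g7/g8 chain).  (iii) `a ∈ [a₋, a₊]`, `0 < a₋` (the paper takes `a = 1`, p. 26); `a′` (the
coefficient of the model's `Q*Q` term) is free, as in pv15's leaf.  (iv) `dist` = sup torus distance in fine lattice
steps (`B5TorusCover.UT.dist_eq`); `dist/n` = the same in the paper's length units (`T_η` has spacing `η = 1/n`,
so `dist/n` is the printed `|x − x′|`, `|z₁ − z₂|`, and `M₀′` is the printed `M₀`: «exp(−⅓δ′₀|z₁ − z₂|) =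
exp(−⅓δ′₀M₀|z′₁ − z′₂|)» with `z′` the cube labels; pv15's `M₀ = M₀′n` counts fine sites per cube side).  (v) The elementary bound
`latticeConst_D(t/n) ≤ n^D·(2(1 + D/t))^D` (`latticeConst_div_le`) is what cancels the `η^{D}` of the kernel
normalisation against the fine-lattice Schur sums inside the leaf; the remaining `η²` cancels `M₀ = M₀′n` and the
`1/δ`-factor.  (vi) An admissible `Dg` (with equality in the hypothesis `√dirichlet(A) ≤ ‖Dg A‖`) is pv15-g6's
`B5DirichletDg.dirOp` (`sqrt_dirichlet_le_norm_dirOp`); it is not imported here.  value = kernel certificate of a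
printed by-reference step in a MODEL case, NOT summit progress.
-/

namespace Literature.MathematicalPhysics.QuantumFieldTheory.Balaban1983to89.B5Bound128Uniform

open Finset
open Literature.MathematicalPhysics.QuantumFieldTheory.Balaban1983to89.B4TorusKernel
open Literature.MathematicalPhysics.QuantumFieldTheory.Balaban1983to89.B4Sect5Torus
open Literature.MathematicalPhysics.QuantumFieldTheory.Balaban1983to89.B5TorusCover
open Literature.MathematicalPhysics.QuantumFieldTheory.Balaban1983to89.B5QGGQ145Bounds
open Literature.MathematicalPhysics.QuantumFieldTheory.Balaban1983to89.B5QGGQ145Factor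
open Literature.MathematicalPhysics.QuantumFieldTheory.Balaban1983to89.B5DPD126Uniform
open scoped Real Matrix

noncomputable section

variable {d : ℕ}

/-! ### §1 The kernel on pv15's vector-field carrier -/

/-- the UNIT forward-difference matrix of the fine torus in direction `μ`: `(∇ᵘ_μ f)(x) = f(x + e_μ) − f(x)`
(torus wrap `B5DPD126Uniform.fup`). [folklore] -/
def unitDiff (P : Fin (d + 1) → ℕ) (μ : Fin (d + 1)) : Matrix (Idx P) (Idx P) ℝ :=
  Matrix.of fun x x'' => (if x'' = fup μ x then 1 else 0) - (if x'' = x then 1 else 0)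

/-- `∂^η_μ = n·∇ᵘ_μ` as matrices: `Dmat n P μ = n • unitDiff P μ`. [folklore] -/
theorem Dmat_eq_smul_unitDiff (n : ℕ) (P : Fin (d + 1) → ℕ) (μ : Fin (d + 1)) :
    Dmat n P μ = (n : ℝ) • unitDiff P μ := by
  ext x x''
  simp [Dmat, unitDiff, Matrix.smul_apply]

/-- `∇ᵘ_μ = n⁻¹ • ∂^η_μ` for `n ≠ 0`. [folklore] -/
theorem unitDiff_eq_smul_Dmat (n : ℕ) [NeZero n] (P : Fin (d + 1) → ℕ) (μ : Fin (d + 1)) :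
    unitDiff P μ = ((n : ℝ))⁻¹ • Dmat n P μ := by
  rw [Dmat_eq_smul_unitDiff, smul_smul, inv_mul_cancel₀ (by exact_mod_cast NeZero.ne n), one_smul]

/-- **THE `∂P∂*` KERNEL OF THE MULTIPLIER MODEL ON pv15's CARRIER** `UT(n·N) × Fin (d+1)`:
`kV (x,μ) (x′,ν) := −(∇ᵘ_μ · (KRe·kerRe·QGRe) · (∇ᵘ_ν)ᵀ)(x,x′)` — the model's `k` in `Δ + a′Q*Q + k`
(sign: `Δ_a = Δ + aQ*Q − ∂P∂*`, (1.121)). [cite: Balaban1984PropagatorsI, (1.121) p.37, (1.126) p.38] -/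
def kV (n : ℕ) [NeZero n] (a : ℝ) (N : Fin (d + 1) → ℕ) :
    UT (fun i => n * N i) × Fin (d + 1) → UT (fun i => n * N i) × Fin (d + 1) → ℝ :=
  fun i j => -((unitDiff (fun i => n * N i) i.2 * (KRe n a N * kerRe n a N * QGRe n a N)
      * (unitDiff (fun i => n * N i) j.2)ᵀ) (UT.toSite (fun i => n * N i) i.1) (UT.toSite (fun i => n * N i) j.1))

/-- `kV = −η^{d+3}·dpd` (`η = 1/n`; `d+3 = (d+1) + 2`: the `η^{d+1}` of the counting-measure kernel of `∂^ηP∂^{η*}`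
and the `η²` of `∇ᵘ = η∂^η` twice). [folklore] -/
theorem kV_eq (n : ℕ) [NeZero n] (a : ℝ) {N : Fin (d + 1) → ℕ} (hN : ∀ i, 1 ≤ N i)
    (i j : UT (fun i => n * N i) × Fin (d + 1)) :
    kV n a N i j = -(((n : ℝ) ^ (d + 3))⁻¹ *
      dpd n a N i.2 j.2 (UT.toSite (fun i => n * N i) i.1) (UT.toSite (fun i => n * N i) j.1)) := by
  have hn : (n : ℝ) ≠ 0 := by exact_mod_cast NeZero.ne n
  unfold kV
  rw [unitDiff_eq_smul_Dmat n, unitDiff_eq_smul_Dmat n, Matrix.transpose_smul, Matrix.smul_mul, Matrix.smul_mul,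
    Matrix.mul_smul, Dmat_matrixP_Dmat_transpose n a hN, smul_smul, smul_smul, Matrix.smul_apply, smul_eq_mul]
  congr 2
  rw [pow_succ, pow_succ, mul_inv, mul_inv]
  ring

/-- **THE `k`-UNIFORM KERNEL BOUND ON pv15's CARRIER**: for `0 < a₋ ≤ a₊` there are `δ > 0`, `C ≥ 0` (depending on
`d, a₋, a₊` only) with `|kV n a N (i,j)| ≤ (C/n^{d+3})·e^{−(δ/n)·dist(i.1, j.1)}` for every `n ≥ 1`, `a ∈ [a₋,a₊]`,
every torus and all `i, j` (`dist` = sup torus distance in fine lattice steps). [cite: Balaban1984PropagatorsI,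
(1.126) p.38 ("The constant O(1) in (1.126) depends on d only")] -/
theorem kV_decay (d : ℕ) (aminus aplus : ℝ) (ha : 0 < aminus) :
    ∃ δ C : ℝ, 0 < δ ∧ 0 ≤ C ∧ ∀ (n : ℕ) [NeZero n] (a : ℝ), aminus ≤ a → a ≤ aplus →
      ∀ (N : Fin (d + 1) → ℕ) [∀ i, NeZero (N i)] (i j : UT (fun i => n * N i) × Fin (d + 1)),
        |kV n a N i j| ≤ ((n : ℝ) ^ (d + 3))⁻¹ * C * Real.exp (-(δ / n * dist i.1 j.1)) := by
  obtain ⟨δ, C, hδ, hC, h⟩ := dpd_decay_uniform_fine d aminus aplus ha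
  refine ⟨δ, C, hδ, hC, fun n _ a ha1 ha2 N _ i j => ?_⟩
  have hN : ∀ i, 1 ≤ N i := UT.one_le N
  rw [kV_eq n a hN, abs_neg, abs_mul, abs_of_nonneg (by positivity : (0 : ℝ) ≤ ((n : ℝ) ^ (d + 3))⁻¹), mul_assoc,
    UT.dist_eq]
  exact mul_le_mul_of_nonneg_left (h n a ha1 ha2 N hN i.2 j.2 _ _) (by positivity)

/-! ### §2 Two scaling identities -/

/-- `(1 − e^{−s})⁻¹ ≤ 1 + s⁻¹` for `s > 0` (from `1 + s ≤ e^{s}`). [folklore] -/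
theorem inv_one_sub_exp_neg_le {s : ℝ} (hs : 0 < s) : (1 - Real.exp (-s))⁻¹ ≤ 1 + s⁻¹ := by
  have h1 : Real.exp (-s) ≤ (1 + s)⁻¹ := by
    rw [Real.exp_neg]
    exact inv_anti₀ (by positivity) (by linarith [Real.add_one_le_exp s])
  have hpos : 0 < s / (1 + s) := by positivity
  have hle : s / (1 + s) ≤ 1 - Real.exp (-s) := by
    have h3 : s / (1 + s) = 1 - (1 + s)⁻¹ := by
      field_simp
      ring
    rw [h3]
    linarith
  calc (1 - Real.exp (-s))⁻¹ ≤ (s / (1 + s))⁻¹ := inv_anti₀ hpos hle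
    _ = 1 + s⁻¹ := by
      field_simp
      ring

/-- **THE FINE-LATTICE SCHUR CONSTANT AT RATE `t/n` COSTS `n^D`**: `latticeConst_D(t/n) ≤ n^D·(2(1 + D/t))^D`
for `t > 0`, `n ≥ 1` (`latticeConst_D(a) = (2(1 − e^{−a/D})⁻¹)^D`). [folklore] -/
theorem latticeConst_div_le (D : ℕ) {t : ℝ} (ht : 0 < t) {n : ℕ} (hn : 1 ≤ n) :
    B4Sect5Proof.latticeConst D (t / n) ≤ (n : ℝ) ^ D * (2 * (1 + D / t)) ^ D := by
  rcases Nat.eq_zero_or_pos D with hD | hD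
  · subst hD
    simp [B4Sect5Proof.latticeConst]
  have hn1 : (1 : ℝ) ≤ n := by exact_mod_cast hn
  have hD0 : (0 : ℝ) < D := by exact_mod_cast hD
  have hs : 0 < t / n / D := by positivity
  have key : (1 - Real.exp (-(t / n / D)))⁻¹ ≤ n * (1 + D / t) := by
    refine (inv_one_sub_exp_neg_le hs).trans ?_
    have e1 : (t / n / D)⁻¹ = n * (D / t) := by
      field_simp
    rw [e1]
    nlinarith [show (0 : ℝ) ≤ D / t by positivity]
  have hbase : 0 ≤ 2 * (1 - Real.exp (-(t / n / D)))⁻¹ := by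
    have : 0 < 1 - Real.exp (-(t / n / D)) := by
      have : Real.exp (-(t / n / D)) < 1 := Real.exp_lt_one_iff.mpr (by linarith)
      linarith
    positivity
  unfold B4Sect5Proof.latticeConst
  rw [← mul_pow]
  apply pow_le_pow_left₀ hbase
  nlinarith [key]

/-- **`2δ₀` SCALES**: `twoDelta0 (δ/n) (M₀′·n) = twoDelta0 δ M₀′ / n` — with the rate per fine step `δ/n` and cubes
of `M₀′·n` fine sites, pv15's `2δ₀` is the paper's `min{δ/3, M₀′⁻¹}` per UNIT length.
[cite: Balaban1984PropagatorsI, p.38 ("Defining 2δ₀ = min{⅓δ′₀, M₀⁻¹}")] -/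
theorem twoDelta0_div (δ M : ℝ) {n : ℝ} (hn : 0 < n) :
    B5Walk131.twoDelta0 (δ / n) (M * n) = B5Walk131.twoDelta0 δ M / n := by
  unfold B5Walk131.twoDelta0
  rw [div_right_comm, mul_inv, ← div_eq_mul_inv, min_div_div_right hn.le]

/-! ### §3 (1.128) for the concrete kernel, cubes of `M₀` fine sites -/

/-- **(1.128) IN THE TORUS MULTIPLIER MODEL WITH THE `k`-UNIFORM (1.126) AS INPUT** — pv15's
`B5AveragingTorus.h128_balaban_torus` for `Δ + a′Q*Q + kV` on the fine torus `Π_μ ℤ/(nN_μ)` (cubes of `M₀` fine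
sites, `2M₀ ≤ nN_μ`), the kernel hypothesis discharged by `kV_decay` with constant `C/n^{d+3}` and rate `δ/n`:
`δ, C` depend on `d, a₋, a₊` only. [cite: Balaban1984PropagatorsI, (1.128) p.38 with (1.126) p.38] -/
theorem h128_uniform (d : ℕ) (aminus aplus : ℝ) (ha : 0 < aminus) :
    ∃ δ C : ℝ, 0 < δ ∧ 0 ≤ C ∧ ∀ (n : ℕ) [NeZero n], 1 ≤ n → ∀ a : ℝ, aminus ≤ a → a ≤ aplus →
      ∀ (N : Fin (d + 1) → ℕ) [∀ i, NeZero (N i)] (M₀ : ℕ), 1 ≤ M₀ → (∀ i, 2 * M₀ ≤ n * N i) →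
        ∀ (Dg : Module.End ℝ (EuclideanSpace ℝ (UT (fun i => n * N i) × Fin (d + 1)))),
          (∀ A, Real.sqrt (B5Leibniz121.dirichlet
              (B5Leibniz121.axisWC (N := fun i => n * N i) (κ := Fin (d + 1))) A) ≤ ‖Dg A‖) →
        ∀ (a' : ℝ) (z₁ z₂ : B5TorusCover.Ctr (fun i => n * N i) M₀)
          (A : EuclideanSpace ℝ (UT (fun i => n * N i) × Fin (d + 1))),
          ‖B5SmoothPartition.HSop (fun i => n * N i) M₀ (fun p : UT (fun i => n * N i) × Fin (d + 1) => p.1) z₁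
              (B5Local114.Kop
                (B5Commutator128.kerOp (fun i j => B5Leibniz121.lapKer B5Leibniz121.axisWC i j
                    + a' * B5Averaging120.gram120 ((n : ℝ) ^ (d + 1)) (B5AveragingTorus.avgKer n) i j)
                  + B5Commutator128.kerOp (kV n a N))
                (B5SmoothPartition.HSop (fun i => n * N i) M₀
                  (fun p : UT (fun i => n * N i) × Fin (d + 1) => p.1)) z₂ A)‖
            ≤ (((4 * ((d + 1 : ℕ) : ℝ) / M₀ * Real.sqrt (2 * ((d + 1 : ℕ) : ℝ))
                      + 52 * ((d + 1 : ℕ) : ℝ) / (M₀ : ℝ) ^ 2)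
                    + 4 * ((d + 1 : ℕ) : ℝ) / M₀ * (4 * n) * |a'|) * Real.exp (4 + 4 * n / M₀)
                + 4 * ((d + 1 : ℕ) : ℝ) / M₀ * (((n : ℝ) ^ (d + 3))⁻¹ * C) * (24 / (Real.exp 1 * (δ / n)))
                  * (((d + 1 : ℕ) : ℝ) * B4Sect5Proof.latticeConst (d + 1) (δ / n / 8)) * Real.exp 7)
              * Real.exp (-(B5Walk131.twoDelta0 (δ / n) M₀
                  * dist (B5TorusCover.ctrU (fun i => n * N i) M₀ z₁)
                      (B5TorusCover.ctrU (fun i => n * N i) M₀ z₂)))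
              * (‖Dg A‖ + ‖A‖) := by
  obtain ⟨δ, C, hδ, hC, h⟩ := kV_decay d aminus aplus ha
  refine ⟨δ, C, hδ, hC, fun n _ hn1 a ha1 ha2 N _ M₀ hM h2N Dg hDg a' z₁ z₂ A => ?_⟩
  have hn0 : (0 : ℝ) < n := by exact_mod_cast hn1
  have hδn : 0 < δ / n := by positivity
  have hCn : 0 ≤ ((n : ℝ) ^ (d + 3))⁻¹ * C := by positivity
  have hq : ∀ i, 1 ≤ (fun i => n * N i) i / n := fun i => by
    show 1 ≤ n * N i / n
    rw [Nat.mul_div_cancel_left _ (NeZero.pos n)]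
    exact UT.one_le N i
  exact B5AveragingTorus.h128_balaban_torus hM h2N hn1 hq hDg a' (k := kV n a N)
    (fun i j => h n a ha1 ha2 N i j) hCn hδn z₁ z₂ A

/-! ### §4 Cubes of side `M₀′` on the UNIT scale (`M₀ = M₀′·n` fine sites): `k`-uniform constants -/

/-- **(1.128) WITH `k`-UNIFORM CONSTANT AND RATE** — cubes of `M₀ = M₀′·n` fine sites (side `M₀′` on the unit
scale, `2M₀′ ≤ N_μ`): the constant is `(4D√(2D)/(M₀′n) + 52D/(M₀′n)² + 16D|a′|/M₀′)·e^{4+4/M₀′} + E/(M₀′n²)` and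
the rate is `twoDelta0 δ M₀′ / n = min{δ/3, M₀′⁻¹}/n` per fine lattice step, with `δ > 0`, `E ≥ 0` depending on
`d, a₋, a₊` ONLY (`D = d+1`; every occurrence of `n = L^k` is a negative power).  [cite: Balaban1984PropagatorsI,
(1.128) p.38 ("we obtain |h_{z₁}K(h_{z₂})A| ≦ O(M₀⁻¹)e^{−2δ₀|z₁−z₂|}(|∇A| + |A|)", "2δ₀ = min{⅓δ′₀, M₀⁻¹}")] -/
theorem h128_uniform_blocks (d : ℕ) (aminus aplus : ℝ) (ha : 0 < aminus) :
    ∃ δ E : ℝ, 0 < δ ∧ 0 ≤ E ∧ ∀ (n : ℕ) [NeZero n], 1 ≤ n → ∀ a : ℝ, aminus ≤ a → a ≤ aplus →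
      ∀ (N : Fin (d + 1) → ℕ) [∀ i, NeZero (N i)] (M₀' : ℕ), 1 ≤ M₀' → (∀ i, 2 * M₀' ≤ N i) →
        ∀ (Dg : Module.End ℝ (EuclideanSpace ℝ (UT (fun i => n * N i) × Fin (d + 1)))),
          (∀ A, Real.sqrt (B5Leibniz121.dirichlet
              (B5Leibniz121.axisWC (N := fun i => n * N i) (κ := Fin (d + 1))) A) ≤ ‖Dg A‖) →
        ∀ (a' : ℝ) (z₁ z₂ : B5TorusCover.Ctr (fun i => n * N i) (M₀' * n))
          (A : EuclideanSpace ℝ (UT (fun i => n * N i) × Fin (d + 1))),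
          ‖B5SmoothPartition.HSop (fun i => n * N i) (M₀' * n)
              (fun p : UT (fun i => n * N i) × Fin (d + 1) => p.1) z₁
              (B5Local114.Kop
                (B5Commutator128.kerOp (fun i j => B5Leibniz121.lapKer B5Leibniz121.axisWC i j
                    + a' * B5Averaging120.gram120 ((n : ℝ) ^ (d + 1)) (B5AveragingTorus.avgKer n) i j)
                  + B5Commutator128.kerOp (kV n a N))
                (B5SmoothPartition.HSop (fun i => n * N i) (M₀' * n)
                  (fun p : UT (fun i => n * N i) × Fin (d + 1) => p.1)) z₂ A)‖
            ≤ ((4 * ((d : ℝ) + 1) * Real.sqrt (2 * ((d : ℝ) + 1)) / (M₀' * n)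
                  + 52 * ((d : ℝ) + 1) / ((M₀' : ℝ) * n) ^ 2 + 16 * ((d : ℝ) + 1) * |a'| / M₀')
                  * Real.exp (4 + 4 / M₀')
                + E / (M₀' * (n : ℝ) ^ 2))
              * Real.exp (-(B5Walk131.twoDelta0 δ M₀' / n
                  * dist (B5TorusCover.ctrU (fun i => n * N i) (M₀' * n) z₁)
                      (B5TorusCover.ctrU (fun i => n * N i) (M₀' * n) z₂)))
              * (‖Dg A‖ + ‖A‖) := by
  obtain ⟨δ, C, hδ, hC, h⟩ := h128_uniform d aminus aplus ha
  set cL : ℝ := (2 * (1 + ((d + 1 : ℕ) : ℝ) / (δ / 8))) ^ (d + 1) with hcL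
  have hcL0 : 0 ≤ cL := by positivity
  refine ⟨δ, 4 * ((d : ℝ) + 1) * C * (24 / (Real.exp 1 * δ)) * (((d : ℝ) + 1) * cL) * Real.exp 7, hδ,
    by positivity, fun n _ hn1 a ha1 ha2 N _ M₀' hM' h2N' Dg hDg a' z₁ z₂ A => ?_⟩
  have hn0 : (0 : ℝ) < n := by exact_mod_cast hn1
  have hM0 : (0 : ℝ) < M₀' := by exact_mod_cast hM'
  have hn0' : (n : ℝ) ≠ 0 := hn0.ne'
  have hM0' : (M₀' : ℝ) ≠ 0 := hM0.ne'
  have hδ0 : δ ≠ 0 := hδ.ne'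
  have he0 : Real.exp 1 ≠ 0 := (Real.exp_pos 1).ne'
  have hM : 1 ≤ M₀' * n := Nat.mul_pos hM' hn1
  have h2N : ∀ i, 2 * (M₀' * n) ≤ n * N i := fun i =>
    calc 2 * (M₀' * n) = 2 * M₀' * n := by ring
      _ ≤ N i * n := Nat.mul_le_mul_right _ (h2N' i)
      _ = n * N i := mul_comm _ _
  have hL : B4Sect5Proof.latticeConst (d + 1) (δ / n / 8) ≤ (n : ℝ) ^ (d + 1) * cL := by
    rw [div_right_comm, hcL]
    exact latticeConst_div_le (d + 1) (by positivity : (0 : ℝ) < δ / 8) hn1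
  clear_value cL
  have hexp : B5Walk131.twoDelta0 (δ / n) ((M₀' * n : ℕ) : ℝ) = B5Walk131.twoDelta0 δ M₀' / n := by
    push_cast
    exact twoDelta0_div δ M₀' hn0
  refine (h n hn1 a ha1 ha2 N (M₀' * n) hM h2N Dg hDg a' z₁ z₂ A).trans ?_
  rw [hexp]
  push_cast
  refine mul_le_mul_of_nonneg_right (mul_le_mul_of_nonneg_right ?_ (Real.exp_pos _).le) (by positivity)
  rw [mul_div_mul_right (4 : ℝ) (M₀' : ℝ) hn0']
  have hmain : ((4 * ((d : ℝ) + 1) / ((M₀' : ℝ) * n) * Real.sqrt (2 * ((d : ℝ) + 1))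
        + 52 * ((d : ℝ) + 1) / ((M₀' : ℝ) * n) ^ 2)
        + 4 * ((d : ℝ) + 1) / ((M₀' : ℝ) * n) * (4 * n) * |a'|)
      = 4 * ((d : ℝ) + 1) * Real.sqrt (2 * ((d : ℝ) + 1)) / (M₀' * n)
        + 52 * ((d : ℝ) + 1) / ((M₀' : ℝ) * n) ^ 2 + 16 * ((d : ℝ) + 1) * |a'| / M₀' := by
    field_simp
    ring
  have hk : 4 * ((d : ℝ) + 1) / ((M₀' : ℝ) * n) * (((n : ℝ) ^ (d + 3))⁻¹ * C) * (24 / (Real.exp 1 * (δ / n)))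
        * (((d : ℝ) + 1) * B4Sect5Proof.latticeConst (d + 1) (δ / n / 8)) * Real.exp 7
      ≤ 4 * ((d : ℝ) + 1) * C * (24 / (Real.exp 1 * δ)) * (((d : ℝ) + 1) * cL) * Real.exp 7
        / (M₀' * (n : ℝ) ^ 2) := by
    have hΦ : 0 ≤ 4 * ((d : ℝ) + 1) / ((M₀' : ℝ) * n) * (((n : ℝ) ^ (d + 3))⁻¹ * C)
        * (24 / (Real.exp 1 * (δ / n))) * ((d : ℝ) + 1) * Real.exp 7 := by positivity
    calc 4 * ((d : ℝ) + 1) / ((M₀' : ℝ) * n) * (((n : ℝ) ^ (d + 3))⁻¹ * C) * (24 / (Real.exp 1 * (δ / n)))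
          * (((d : ℝ) + 1) * B4Sect5Proof.latticeConst (d + 1) (δ / n / 8)) * Real.exp 7
        = (4 * ((d : ℝ) + 1) / ((M₀' : ℝ) * n) * (((n : ℝ) ^ (d + 3))⁻¹ * C)
            * (24 / (Real.exp 1 * (δ / n))) * ((d : ℝ) + 1) * Real.exp 7)
            * B4Sect5Proof.latticeConst (d + 1) (δ / n / 8) := by ring
      _ ≤ (4 * ((d : ℝ) + 1) / ((M₀' : ℝ) * n) * (((n : ℝ) ^ (d + 3))⁻¹ * C)
            * (24 / (Real.exp 1 * (δ / n))) * ((d : ℝ) + 1) * Real.exp 7) * ((n : ℝ) ^ (d + 1) * cL) :=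
          mul_le_mul_of_nonneg_left hL hΦ
      _ = 4 * ((d : ℝ) + 1) * C * (24 / (Real.exp 1 * δ)) * (((d : ℝ) + 1) * cL) * Real.exp 7
            / (M₀' * (n : ℝ) ^ 2) := by
          field_simp
          ring
  rw [hmain]
  exact add_le_add le_rfl hk

/-- **(1.128), `k`-FREE FORM** — dropping the negative powers of `n = L^k ≥ 1`: for cubes of side `M₀′` on the unit
scale the (1.128) constant is `≤ (4D√(2D)/M₀′ + 52D/M₀′² + 16D|a′|/M₀′)·e^{4+4/M₀′} + E/M₀′ = O(M₀′⁻¹)(1 + |a′|)` and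
the exponential factor is `exp(−twoDelta0 δ M₀′ · dist/n)`, `twoDelta0 δ M₀′ = min{δ/3, M₀′⁻¹}`, `dist/n` = the sup
torus distance of the cube centres on the UNIT scale; `δ > 0`, `E ≥ 0` depend on `d, a₋, a₊` ONLY — uniformly in
`k` and in the volume `N`.  This is the printed «O(M₀⁻¹)» and «2δ₀ = min{⅓δ′₀, M₀⁻¹}» with a `k`-independent `δ′₀`
(torus multiplier model, `U = 1`; dictionary (i)–(v) of the header). [cite: Balaban1984PropagatorsI, (1.128) p.38] -/
theorem h128_uniform_kfree (d : ℕ) (aminus aplus : ℝ) (ha : 0 < aminus) :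
    ∃ δ E : ℝ, 0 < δ ∧ 0 ≤ E ∧ ∀ (n : ℕ) [NeZero n], 1 ≤ n → ∀ a : ℝ, aminus ≤ a → a ≤ aplus →
      ∀ (N : Fin (d + 1) → ℕ) [∀ i, NeZero (N i)] (M₀' : ℕ), 1 ≤ M₀' → (∀ i, 2 * M₀' ≤ N i) →
        ∀ (Dg : Module.End ℝ (EuclideanSpace ℝ (UT (fun i => n * N i) × Fin (d + 1)))),
          (∀ A, Real.sqrt (B5Leibniz121.dirichlet
              (B5Leibniz121.axisWC (N := fun i => n * N i) (κ := Fin (d + 1))) A) ≤ ‖Dg A‖) →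
        ∀ (a' : ℝ) (z₁ z₂ : B5TorusCover.Ctr (fun i => n * N i) (M₀' * n))
          (A : EuclideanSpace ℝ (UT (fun i => n * N i) × Fin (d + 1))),
          ‖B5SmoothPartition.HSop (fun i => n * N i) (M₀' * n)
              (fun p : UT (fun i => n * N i) × Fin (d + 1) => p.1) z₁
              (B5Local114.Kop
                (B5Commutator128.kerOp (fun i j => B5Leibniz121.lapKer B5Leibniz121.axisWC i j
                    + a' * B5Averaging120.gram120 ((n : ℝ) ^ (d + 1)) (B5AveragingTorus.avgKer n) i j)
                  + B5Commutator128.kerOp (kV n a N))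
                (B5SmoothPartition.HSop (fun i => n * N i) (M₀' * n)
                  (fun p : UT (fun i => n * N i) × Fin (d + 1) => p.1)) z₂ A)‖
            ≤ ((4 * ((d : ℝ) + 1) * Real.sqrt (2 * ((d : ℝ) + 1)) / M₀'
                  + 52 * ((d : ℝ) + 1) / (M₀' : ℝ) ^ 2 + 16 * ((d : ℝ) + 1) * |a'| / M₀')
                  * Real.exp (4 + 4 / M₀')
                + E / M₀')
              * Real.exp (-(B5Walk131.twoDelta0 δ M₀'
                  * (dist (B5TorusCover.ctrU (fun i => n * N i) (M₀' * n) z₁)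
                      (B5TorusCover.ctrU (fun i => n * N i) (M₀' * n) z₂) / n)))
              * (‖Dg A‖ + ‖A‖) := by
  obtain ⟨δ, E, hδ, hE, h⟩ := h128_uniform_blocks d aminus aplus ha
  refine ⟨δ, E, hδ, hE, fun n _ hn1 a ha1 ha2 N _ M₀' hM' h2N' Dg hDg a' z₁ z₂ A => ?_⟩
  have hn1' : (1 : ℝ) ≤ n := by exact_mod_cast hn1
  have hM0 : (0 : ℝ) < M₀' := by exact_mod_cast hM'
  have hMn : (M₀' : ℝ) ≤ M₀' * n := le_mul_of_one_le_right hM0.le hn1'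
  have hMn2 : (M₀' : ℝ) ≤ M₀' * (n : ℝ) ^ 2 := le_mul_of_one_le_right hM0.le (one_le_pow₀ hn1')
  refine (h n hn1 a ha1 ha2 N M₀' hM' h2N' Dg hDg a' z₁ z₂ A).trans ?_
  rw [div_mul_eq_mul_div (B5Walk131.twoDelta0 δ M₀') (n : ℝ), mul_div_assoc (B5Walk131.twoDelta0 δ M₀')]
  refine mul_le_mul_of_nonneg_right (mul_le_mul_of_nonneg_right ?_ (Real.exp_pos _).le) (by positivity)
  have h1 : 4 * ((d : ℝ) + 1) * Real.sqrt (2 * ((d : ℝ) + 1)) / (M₀' * n)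
      ≤ 4 * ((d : ℝ) + 1) * Real.sqrt (2 * ((d : ℝ) + 1)) / M₀' :=
    div_le_div_of_nonneg_left (by positivity) hM0 hMn
  have h2 : 52 * ((d : ℝ) + 1) / ((M₀' : ℝ) * n) ^ 2 ≤ 52 * ((d : ℝ) + 1) / (M₀' : ℝ) ^ 2 :=
    div_le_div_of_nonneg_left (by positivity) (by positivity) (pow_le_pow_left₀ hM0.le hMn 2)
  have h3 : E / (M₀' * (n : ℝ) ^ 2) ≤ E / M₀' := div_le_div_of_nonneg_left hE hM0 hMn2
  have hexp : 0 ≤ Real.exp (4 + 4 / (M₀' : ℝ)) := (Real.exp_pos _).le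
  have h4 : (4 * ((d : ℝ) + 1) * Real.sqrt (2 * ((d : ℝ) + 1)) / (M₀' * n)
        + 52 * ((d : ℝ) + 1) / ((M₀' : ℝ) * n) ^ 2 + 16 * ((d : ℝ) + 1) * |a'| / M₀') * Real.exp (4 + 4 / M₀')
      ≤ (4 * ((d : ℝ) + 1) * Real.sqrt (2 * ((d : ℝ) + 1)) / M₀'
        + 52 * ((d : ℝ) + 1) / (M₀' : ℝ) ^ 2 + 16 * ((d : ℝ) + 1) * |a'| / M₀') * Real.exp (4 + 4 / M₀') :=
    mul_le_mul_of_nonneg_right (add_le_add (add_le_add h1 h2) le_rfl) hexp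
  exact add_le_add h4 h3

end

end Literature.MathematicalPhysics.QuantumFieldTheory.Balaban1983to89.B5Bound128Uniform
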